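import Summits.Ventures.PercRepro.RankLevelSetMultCubeCount

/-!
# PercRepro — THE CUBE-CAP `U`-COUNT WITH THE INDEPENDENT `q`-SETS KEPT EXACT AND COINDEPENDENT (p8 g12, S3)

`proofs/P8-G12-LEVER22.md` §6, recipe step (2). `Matroid.ncard_eRk_eq_ncard_le_le_heavy_cube_cap_indep`
(RankLevelSetMultCubeCountIndep, p8 g8) with the spanning of the complement `r(E ∖ B) = r(E)` carried from the counted
family into its first class: `#{B ⊆ E : r(B) = q, |B| ≤ d, E ∖ B spans} ≤ #{B ⊆ E : |B| = q, r(B) = q, E ∖ B spans}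
+ σ³·#(light small pairs) + σ³·#(light big pairs) + #{heavy sets of ≤ d elements}`. The proof is the g8 one with the
split `S ⊆ S₁ ∪ S₂` carrying the conjunct; the dense classes are unchanged. With two distinct triangles the first class
numbers at most `C(n, 6) − C(n − 6, 6)` at `q = 6`, `d ≤ 7` (`ncard_indep_six_coindep_add_choose_le_of_two_triangles`,
RankLevelSetTopCountCoindep). Axioms: standard.
-/

open scoped Matroid

namespace PercRepro

namespace Matroid

open Set Finset

variable {α : Type}

open scoped Classical in
/-- **The `U`-count with the heavy / light split, the cubic multiplicity and the size-capped heavy term, WITH THE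
INDEPENDENT `q`-SETS KEPT EXACT AND COINDEPENDENT**: `ncard_eRk_eq_ncard_le_le_heavy_cube_cap_indep` with the
spanning of the complement carried into the first class. -/
theorem ncard_eRk_eq_ncard_le_le_heavy_cube_cap_indep_coindep (M : _root_.Matroid α) [M.Finite] (q f' ν₁ : ℕ) (hq : 1 ≤ q)
    (hcirc : ∀ C, M.IsCircuit C → 3 ≤ C.encard) (hline : ∀ L ⊆ M.E, M.eRk L = 2 → L.ncard ≤ 3) (d : ℕ) :
    ({B : Set α | B ⊆ M.E ∧ M.eRk B = q ∧ B.ncard ≤ d ∧ M.eRk (M.E \ B) = M.eRank}.ncard : ℚ) ≤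
      ({B : Set α | B ⊆ M.E ∧ B.ncard = q ∧ M.eRk B = q ∧ M.eRk (M.E \ B) = M.eRank}.ncard : ℚ) +
        (∑ j ∈ Finset.range (d - (q + 1) + 1), ((min (f' - q) (ν₁ - 2)).choose j : ℚ) * (1 / ((((j + 1) * ((j + 1) ^ 2 + 1) / 2 : ℕ) : ℚ)))) *
          (((pairsLight M q ν₁).filter (fun p => p ∈ pairsSmall M q f')).card : ℚ) +
        (∑ j ∈ Finset.range (d - (q + 1) + 1), ((ν₁ - 2).choose j : ℚ) * (1 / ((((j + 1) * ((j + 1) ^ 2 + 1) / 2 : ℕ) : ℚ)))) *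
          (((pairsLight M q ν₁).filter (fun p => p ∉ pairsSmall M q f')).card : ℚ) +
        ({B : Set α | B ⊆ M.E ∧ M.eRk B = (q : ℕ∞) ∧ q + ν₁ ≤ (M.closure B).ncard ∧ B.ncard ≤ d}.ncard : ℚ) := by
  set S := {B : Set α | B ⊆ M.E ∧ M.eRk B = q ∧ B.ncard ≤ d ∧ M.eRk (M.E \ B) = M.eRank} with hS
  set S₁ := {B : Set α | B ⊆ M.E ∧ B.ncard = q ∧ M.eRk B = q ∧ M.eRk (M.E \ B) = M.eRank} with hS₁
  set S₂ := {B : Set α | B ⊆ M.E ∧ M.eRk B = q ∧ q < B.ncard ∧ B.ncard ≤ d} with hS₂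
  set Hv := {B : Set α | B ⊆ M.E ∧ M.eRk B = (q : ℕ∞) ∧ q + ν₁ ≤ (M.closure B).ncard ∧ B.ncard ≤ d} with hHv
  set Ps := ((pairsLight M q ν₁).filter (fun p => p ∈ pairsSmall M q f')).card with hPs
  set Pb := ((pairsLight M q ν₁).filter (fun p => p ∉ pairsSmall M q f')).card with hPb
  have hsplit : S ⊆ S₁ ∪ S₂ := by
    intro B hB
    have hBfin : B.Finite := M.ground_finite.subset hB.1
    have hle : q ≤ B.ncard := by
      have := M.eRk_le_encard B
      rw [hB.2.1, ← hBfin.cast_ncard_eq] at this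
      exact_mod_cast this
    rcases hle.lt_or_eq with h | h
    · exact Or.inr ⟨hB.1, hB.2.1, h, hB.2.2.1⟩
    · exact Or.inl ⟨hB.1, h.symm, hB.2.1, hB.2.2.2⟩
  have hS₁fin : S₁.Finite := M.ground_finite.finite_subsets.subset (fun B hB => hB.1)
  have hS₂fin : S₂.Finite := M.ground_finite.finite_subsets.subset (fun B hB => hB.1)
  -- the light levels
  have hlevel : ∀ m ∈ Finset.Icc (q + 1) d, ((levelLight M q ν₁ m).card : ℚ) ≤
      ((Ps : ℚ) * ((min (f' - q) (ν₁ - 2)).choose (m - (q + 1)) : ℚ) +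
        (Pb : ℚ) * ((ν₁ - 2).choose (m - (q + 1)) : ℚ)) *
        (1 / ((((m - q) * ((m - q) ^ 2 + 1) / 2 : ℕ) : ℚ))) := by
    intro m hm
    rw [Finset.mem_Icc] at hm
    have hpos : (0 : ℚ) < ((((m - q) * ((m - q) ^ 2 + 1) / 2) : ℕ) : ℚ) := by
      have h1 : 1 ≤ m - q := by omega
      have h2 : 1 ≤ (m - q) * ((m - q) ^ 2 + 1) / 2 := by
        rw [← cube_choose_eq]; omega
      exact_mod_cast h2
    rw [mul_div_assoc', le_div_iff₀ hpos, mul_one, mul_comm]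
    have h := mul_card_levelLight_le_cube q f' ν₁ hq hcirc hline m
    exact_mod_cast h
  -- the levels
  have hS₂q : (S₂.ncard : ℚ) ≤ ∑ m ∈ Finset.Icc (q + 1) d,
      ((Ps : ℚ) * ((min (f' - q) (ν₁ - 2)).choose (m - (q + 1)) : ℚ) +
        (Pb : ℚ) * ((ν₁ - 2).choose (m - (q + 1)) : ℚ)) *
        (1 / ((((m - q) * ((m - q) ^ 2 + 1) / 2 : ℕ) : ℚ))) + (Hv.ncard : ℚ) := by
    have h3' : ∑ m ∈ Finset.Icc (q + 1) d, (levelHeavy M q ν₁ m).card ≤ Hv.ncard := by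
      rw [hHv]
      exact sum_card_levelHeavy_le_cap q ν₁ d
    have h3q : ((∑ m ∈ Finset.Icc (q + 1) d, (levelHeavy M q ν₁ m).card : ℕ) : ℚ) ≤ (Hv.ncard : ℚ) := by
      exact_mod_cast h3'
    have h2 : ∑ m ∈ Finset.Icc (q + 1) d, (levelF M q m).card =
        ∑ m ∈ Finset.Icc (q + 1) d, (levelLight M q ν₁ m).card +
          ∑ m ∈ Finset.Icc (q + 1) d, (levelHeavy M q ν₁ m).card := by
      rw [← Finset.sum_add_distrib]
      exact Finset.sum_congr rfl (fun m _ => card_levelF_eq_light_add_heavy q ν₁ m)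
    calc (S₂.ncard : ℚ) ≤ ((∑ m ∈ Finset.Icc (q + 1) d, (levelF M q m).card : ℕ) : ℚ) := by
          exact_mod_cast ncard_dep_le_sum_levelF q d
      _ = ∑ m ∈ Finset.Icc (q + 1) d, ((levelLight M q ν₁ m).card : ℚ) +
            ((∑ m ∈ Finset.Icc (q + 1) d, (levelHeavy M q ν₁ m).card : ℕ) : ℚ) := by
          rw [h2]
          push_cast
          rfl
      _ ≤ _ := add_le_add (Finset.sum_le_sum hlevel) h3q
  -- re-index the level sums
  have hre : ∑ m ∈ Finset.Icc (q + 1) d,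
      ((Ps : ℚ) * ((min (f' - q) (ν₁ - 2)).choose (m - (q + 1)) : ℚ) +
        (Pb : ℚ) * ((ν₁ - 2).choose (m - (q + 1)) : ℚ)) *
        (1 / ((((m - q) * ((m - q) ^ 2 + 1) / 2 : ℕ) : ℚ))) =
      ∑ j ∈ Finset.range (d - q),
        ((Ps : ℚ) * (((min (f' - q) (ν₁ - 2)).choose j : ℚ) * (1 / ((((j + 1) * ((j + 1) ^ 2 + 1) / 2 : ℕ) : ℚ)))) +
          (Pb : ℚ) * (((ν₁ - 2).choose j : ℚ) * (1 / ((((j + 1) * ((j + 1) ^ 2 + 1) / 2 : ℕ) : ℚ))))) := by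
    rw [show Finset.Icc (q + 1) d = Finset.image (fun j => q + 1 + j) (Finset.range (d - q)) from ?_]
    · rw [Finset.sum_image (fun a _ b _ h => by omega)]
      apply Finset.sum_congr rfl
      intro j _
      rw [show q + 1 + j - (q + 1) = j by omega, show q + 1 + j - q = j + 1 by omega]
      ring
    · ext m
      rw [Finset.mem_Icc, Finset.mem_image]
      constructor
      · intro hm
        exact ⟨m - (q + 1), by rw [Finset.mem_range]; omega, by omega⟩
      · rintro ⟨j, hj, rfl⟩
        rw [Finset.mem_range] at hj
        omega
  have hrange : Finset.range (d - q) ⊆ Finset.range (d - (q + 1) + 1) := Finset.range_mono (by omega)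
  have hS₂q' : (S₂.ncard : ℚ) ≤
      (∑ j ∈ Finset.range (d - (q + 1) + 1), ((min (f' - q) (ν₁ - 2)).choose j : ℚ) * (1 / ((((j + 1) * ((j + 1) ^ 2 + 1) / 2 : ℕ) : ℚ)))) * (Ps : ℚ) +
        (∑ j ∈ Finset.range (d - (q + 1) + 1), ((ν₁ - 2).choose j : ℚ) * (1 / ((((j + 1) * ((j + 1) ^ 2 + 1) / 2 : ℕ) : ℚ)))) * (Pb : ℚ) +
        (Hv.ncard : ℚ) := by
    rw [Finset.sum_mul, Finset.sum_mul]
    refine hS₂q.trans (add_le_add (hre.le.trans ?_) (le_refl _))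
    rw [Finset.sum_add_distrib]
    apply add_le_add
    · refine (Finset.sum_le_sum_of_subset_of_nonneg hrange (fun j _ _ => by positivity)).trans' ?_
      apply le_of_eq
      apply Finset.sum_congr rfl
      intro j _
      ring
    · refine (Finset.sum_le_sum_of_subset_of_nonneg hrange (fun j _ _ => by positivity)).trans' ?_
      apply le_of_eq
      apply Finset.sum_congr rfl
      intro j _
      ring
  have hSq : (S.ncard : ℚ) ≤ (S₁.ncard : ℚ) + (S₂.ncard : ℚ) := by
    have : S.ncard ≤ S₁.ncard + S₂.ncard :=
      (ncard_le_ncard hsplit (hS₁fin.union hS₂fin)).trans (ncard_union_le _ _)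
    exact_mod_cast this
  linarith

end Matroid

end PercRepro
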